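import Summits.Ventures.PercRepro2.CaseOneGadgetUWOMainIIT
import Summits.Ventures.PercRepro2.CaseOneGadgetUWOMainIT
import Summits.Ventures.PercRepro2.CaseOneGadgetUWOAnchor
import Summits.Ventures.PercRepro2.CaseOneCoreTF

/-!
# The gadget `u ~ {w, o}`, `w ~ {u, a₁, a₂, b}` (uwo) is an anchor of the six-form calculus
(blind cell PercRepro2, p1 g32; the second four-form gadget anchor gets its six-form twin)

With `(ii-T)` / `(i-T)` at `u` for the uwo gadget (`zSplitIIT_of_gadgetUWO` / `zSplitIT_of_gadgetUWO`,
CaseOneGadgetUWOMainIIT / MainIT) next to its four forms (`fourForms_of_gadgetUWO`, CaseOneGadgetUWOAnchor):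
**`sixForms_of_gadgetUWO`**, **`closedAtT_of_gadgetUWO`**, **`closedAtT_of_gadgetUWOAnchor`**. The anchor
set of the six-form calculus grows by `GadgetUWOAnchor` — a class OUTSIDE the four-form `ClosedAnchor` —:
`ClosedAnchorTO := ClosedAnchorTM ∨ GadgetUWOAnchor`, **`closedAtT_of_closedAnchorTO`**, the `a₂`-free
residual core `InCoreTO` relative to it (and to its faces, `ClosedAnchorTOF` / `InCoreTOF`) and the
reductions **`closedAtT_of_coreTO`** / **`closedAtT_of_coreTOF`**. Own code; standard axioms. -/

namespace Summit.Ventures.PercRepro2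

namespace CaseOne

universe u

section GadgetUWOT
variable {V : Type*} {E : Type*} [Fintype E] [DecidableEq E] [Fintype V] [DecidableEq V]
  {R : Type*} [Field R] [LinearOrder R] [IsStrictOrderedRing R]
variable {ends : E → Sym2 V} {o a₁ a₂ b u w : V} {euw euo ewa1 ewa2 ewb : E}

/-- **The six forms at `u` for the uwo gadget**, every finite graph, every weight vector. -/
theorem sixForms_of_gadgetUWO (p : E → R) (hp : IsProbVec p)
    (h : IsGadgetUWO ends o a₁ a₂ b u w euw euo ewa1 ewa2 ewb) : SixForms p ends o a₁ a₂ u b := by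
  obtain ⟨k1, k2, k3, k4⟩ := fourForms_of_gadgetUWO p hp h
  exact ⟨k1, k2, zSplitIIT_of_gadgetUWO p hp h, k3, k4, zSplitIT_of_gadgetUWO p hp h⟩

/-- **The uwo gadget is an anchor of the six-form calculus.** -/
theorem closedAtT_of_gadgetUWO (h : IsGadgetUWO ends o a₁ a₂ b u w euw euo ewa1 ewa2 ewb) :
    ClosedAtT (R := R) o a₁ a₂ b E ends u :=
  fun p hp => sixForms_of_gadgetUWO p hp h

end GadgetUWOT

section AnchorsTO
variable {V : Type*}

/-- **The anchors of the six-form calculus with the uwo gadget**: `ClosedAnchorTM` or a uwo-gadget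
anchor. -/
def ClosedAnchorTO (o a₁ a₂ b : V) (E : Type u) (ends : E → Sym2 V) (v : V) : Prop :=
  ClosedAnchorTM o a₁ a₂ b E ends v ∨ GadgetUWOAnchor o a₁ a₂ b E ends v

variable (o a₁ a₂ b : V) [Fintype V] [DecidableEq V] {R : Type*} [Field R] [LinearOrder R]
  [IsStrictOrderedRing R]

/-- **A uwo-gadget anchor is six-form closed.** -/
theorem closedAtT_of_gadgetUWOAnchor (E : Type u) [Fintype E] [DecidableEq E] (ends : E → Sym2 V)
    (v : V) (h : GadgetUWOAnchor o a₁ a₂ b E ends v) : ClosedAtT (R := R) o a₁ a₂ b E ends v := by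
  obtain ⟨w, euw, euo, ewa1, ewa2, ewb, h⟩ := h
  exact closedAtT_of_gadgetUWO h

/-- **A `ClosedAnchorTO` anchor is six-form closed.** -/
theorem closedAtT_of_closedAnchorTO (E : Type u) [Fintype E] [DecidableEq E] (ends : E → Sym2 V)
    (v : V) (h : ClosedAnchorTO o a₁ a₂ b E ends v) : ClosedAtT (R := R) o a₁ a₂ b E ends v := by
  rcases h with h | h
  · exact closedAtT_of_closedAnchorTM o a₁ a₂ b E ends v h
  · exact closedAtT_of_gadgetUWOAnchor o a₁ a₂ b E ends v h

variable (v : V)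

/-- **The `a₂`-free residual core relative to `ClosedAnchorTO`.** -/
def InCoreTO (E : Type u) [Fintype E] [DecidableEq E] (ends : E → Sym2 V) : Prop :=
  InCoreTAnc o a₁ a₂ b v (fun E₀ _ _ ends₀ v₀ => ClosedAnchorTO o a₁ a₂ b E₀ ends₀ v₀) E ends

/-- **The reduction to the `a₂`-free residual core with the uwo gadget among the anchors.** -/
theorem closedAtT_of_coreTO
    (hcore : ∀ (E' : Type u) [Fintype E'] [DecidableEq E'] (ends' : E' → Sym2 V),
      InCoreTO o a₁ a₂ b v E' ends' → ClosedAtT (R := R) o a₁ a₂ b E' ends' v) :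
    ∀ (E : Type u) [Fintype E] [DecidableEq E] (ends : E → Sym2 V),
      ClosedAtT (R := R) o a₁ a₂ b E ends v :=
  closedAtT_of_coreTAnc o a₁ a₂ b v _
    (fun E₀ _ _ ends₀ v₀ h => closedAtT_of_closedAnchorTO o a₁ a₂ b E₀ ends₀ v₀ h) hcore

/-- **The anchors with the uwo gadget and all their faces.** -/
def ClosedAnchorTOF (E : Type u) [Fintype E] [DecidableEq E] (ends : E → Sym2 V) (v : V) : Prop :=
  ∃ n : ℕ, FaceAnchorN (fun E₀ _ _ ends₀ v₀ => ClosedAnchorTO o a₁ a₂ b E₀ ends₀ v₀) n E ends v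

/-- **A `ClosedAnchorTOF` anchor is six-form closed.** -/
theorem closedAtT_of_closedAnchorTOF (E : Type u) [Fintype E] [DecidableEq E] (ends : E → Sym2 V)
    (v : V) (h : ClosedAnchorTOF o a₁ a₂ b E ends v) : ClosedAtT (R := R) o a₁ a₂ b E ends v := by
  obtain ⟨n, hn⟩ := h
  exact closedAtT_of_faceAnchorN o a₁ a₂ b _
    (fun E₀ _ _ ends₀ v₀ h₀ => closedAtT_of_closedAnchorTO o a₁ a₂ b E₀ ends₀ v₀ h₀) n E ends v hn

/-- **The `a₂`-free residual core relative to the anchors with the uwo gadget and their faces.** -/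
def InCoreTOF (E : Type u) [Fintype E] [DecidableEq E] (ends : E → Sym2 V) : Prop :=
  InCoreTAnc o a₁ a₂ b v (fun E₀ _ _ ends₀ v₀ => ClosedAnchorTOF o a₁ a₂ b E₀ ends₀ v₀) E ends

/-- **The reduction to `InCoreTOF`.** -/
theorem closedAtT_of_coreTOF
    (hcore : ∀ (E' : Type u) [Fintype E'] [DecidableEq E'] (ends' : E' → Sym2 V),
      InCoreTOF o a₁ a₂ b v E' ends' → ClosedAtT (R := R) o a₁ a₂ b E' ends' v) :
    ∀ (E : Type u) [Fintype E] [DecidableEq E] (ends : E → Sym2 V),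
      ClosedAtT (R := R) o a₁ a₂ b E ends v :=
  closedAtT_of_coreTAnc o a₁ a₂ b v _
    (fun E₀ _ _ ends₀ v₀ h => closedAtT_of_closedAnchorTOF o a₁ a₂ b E₀ ends₀ v₀ h) hcore

end AnchorsTO

end CaseOne

end Summit.Ventures.PercRepro2
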